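import Literature.AlgebraicGeometry.Resolution.InseparableLocalUniformizationCurvesStepOne
import Literature.AlgebraicGeometry.Resolution.ValuationRingOpenInNormalizationProofs
import HarnessLib

/-!
# Fine `K`-rational models: the local ring of the normalization exhausts the valuation ring

Topic: `Literature/AlgebraicGeometry/Resolution` (valued function fields; models over valuation
rings). Groundwork for the algebraization step of M. Temkin, *Inseparable local uniformization*,
J. Algebra 373 (2013) = arXiv:0804.1554v3, Thm. 3.3.1 (tree: the named fact
`Temkin2013RelativeCurveSmoothFibre`). Its conclusion concerns the local ring at the centre `z₁`
of a valuation ring `O₁` of a finite extension `L₁ ⊇ K` on the normalization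
`N = Nr_{L₁}(A′)` of a `K`-RATIONAL affine normalized model `A′ ⊆ K°` which we are free to
refine. The point of this file: refining `A′` by finitely many elements of `K° = K ∩ O₁` makes
the local ring `N_{z₁}` contain any prescribed finite subset of `O₁` — indeed a single
localization `N[1/f]`, `f` a unit of `O₁`, does (Bourbaki, *Alg. comm.* VI §8 no. 6 Prop. 6:
`O₁ = Nr_{L₁}(K°)_𝔪`; in the tree as the discharged fact `Temkin2013_valuationRingOpen`:
`O₁ = Nr_{L₁}(K°)[1/f]` for `K°` of finite height). So the `K`-rationality of the model is no
obstruction to seeing finitely many given `L₁`-rational (or `K₁`-rational) functions regular at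
the point: Temkin's norm/Weierstrass argument (proof of Thm. 3.3.1, Step 3, p. 45: "Replacing
`f_j` by `g_j`'s we achieve that `𝔙_η ⥲ X_η{f₁, …, f_n}` for … `f_j ∈ A_π`") is replaced by this
piece of commutative algebra.

* `eq_nrIn_of_coe_eq`, `IsAffineNormalizedModel.refine` — an affine normalized
  model is `Nr_K(k°[s])`, and adjoining finitely many elements of `K°` refines it — PROVED;
* `isIntegral_of_monic_of_coeff_mem`, `mem_valuationSubring_of_isIntegral_subring`,
  `nrIn_map_le_valuationSubring` — bookkeeping: integrality from a monic polynomial with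
  coefficients in a subring; `Nr_{L₁}(A′) ⊆ O₁` — PROVED;
* `exists_fine_model` — **for every finite `W ⊆ O₁` there are a refinement `A ≤ A′` (again an
  affine normalized model of `K°` over `k°`) and `f ∈ Nr_{L₁}(A′)` with `|f|_{O₁} = 1` such that
  every `w ∈ W` is `a / fⁿ` with `a ∈ Nr_{L₁}(A′)`** — PROVED.

All statements are [folklore]; no definitions, no named facts.

## Sources

* N. Bourbaki, *Algèbre commutative* VI §8 no. 6, Prop. 6 (through the tree:
  `Temkin2013_valuationRingOpen_holds`, `ValuationRingOpenInNormalizationProofs.lean`).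
* M. Temkin, arXiv:0804.1554v3, §3.3 (affine normalized models, p. 44) and the proof of
  Thm. 3.3.1, Step 3 (p. 45) (the use).
-/

noncomputable section

open Polynomial

namespace Literature.AlgebraicGeometry.Resolution

universe u

/-! ### Integrality bookkeeping -/

section Bookkeeping

variable {L : Type u} [Field L]

/-- A root of a monic polynomial over `L` with coefficients in a subring `S` is integral over `S`.
[folklore] -/
theorem isIntegral_of_monic_of_coeff_mem (S : Subring L) {P : L[X]} (hPm : P.Monic)
    (hP : ∀ i, P.coeff i ∈ S) {x : L} (hx : P.eval x = 0) : IsIntegral S x := by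
  have hlifts : P ∈ Polynomial.lifts (algebraMap S L) :=
    (Polynomial.lifts_iff_coeff_lifts _).mpr fun n => ⟨⟨P.coeff n, hP n⟩, rfl⟩
  obtain ⟨q, hq, -, hqm⟩ := Polynomial.lifts_and_degree_eq_and_monic hlifts hPm
  refine ⟨q, hqm, ?_⟩
  have h3 : Polynomial.eval₂ (algebraMap S L) x q = (q.map (algebraMap S L)).eval x := by
    rw [Polynomial.eval_map]
  rw [h3, hq, hx]

/-- Valuation rings are integrally closed: an element integral over a subring of `W` lies in
`W`. [folklore] -/
theorem mem_valuationSubring_of_isIntegral_subring (W : ValuationSubring L) {S : Subring L}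
    (hS : S ≤ W.toSubring) {x : L} (hx : IsIntegral S x) : x ∈ W := by
  letI : Algebra S W := (Subring.inclusion hS).toAlgebra
  haveI : IsScalarTower S W L := IsScalarTower.of_algebraMap_eq fun _ => rfl
  have hx' : IsIntegral W x := hx.tower_top
  obtain ⟨y, hy⟩ := IsIntegrallyClosed.algebraMap_eq_of_integral hx'
  rw [← hy]
  exact y.2

end Bookkeeping

/-! ### Refining an affine normalized model -/

section Models

variable {K : Type u} [Field K]

/-- An affine normalized model with data `s` is `Nr_K(k°[s])`. [folklore] -/
theorem eq_nrIn_of_coe_eq {R₀ A : Subring K} {s : Finset K}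
    (hA : (A : Set K) = {x : K | IsIntegral (Subring.closure ((R₀ : Set K) ∪ ↑s)) x}) :
    A = nrIn (Subring.closure ((R₀ : Set K) ∪ ↑s)) :=
  SetLike.coe_injective (hA.trans (coe_nrIn _).symm)

/-- **Refinement by finitely many integral functions**: adjoining a finite `s′ ⊆ K°` to an affine
normalized model `A` of `K°` over `k°` gives an affine normalized model `A′ ≥ A` containing `s′`.
[folklore] -/
theorem IsAffineNormalizedModel.refine {O : ValuationSubring K} {R₀ A : Subring K}
    (hA : IsAffineNormalizedModel O R₀ A) (s' : Finset K) (hs' : (↑s' : Set K) ⊆ (O : Set K)) :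
    ∃ A' : Subring K, A ≤ A' ∧ IsAffineNormalizedModel O R₀ A' ∧ (↑s' : Set K) ⊆ A' := by
  classical
  obtain ⟨s, hsO, hAeq, hAfr⟩ := hA
  set C' : Subring K := Subring.closure ((R₀ : Set K) ∪ ↑(s ∪ s')) with hC'
  have hAA' : A ≤ nrIn C' := by
    rw [eq_nrIn_of_coe_eq hAeq]
    refine nrIn_mono (Subring.closure_mono (Set.union_subset_union_right _ ?_))
    rw [Finset.coe_union]
    exact Set.subset_union_left
  refine ⟨nrIn C', hAA', ⟨s ∪ s', ?_, coe_nrIn C', fun z => ?_⟩, fun x hx => ?_⟩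
  · rw [Finset.coe_union]
    exact Set.union_subset hsO hs'
  · obtain ⟨a, ha, b, hb, rfl⟩ := hAfr z
    exact ⟨a, hAA' ha, b, hAA' hb, rfl⟩
  · refine le_nrIn C' (Subring.subset_closure (Or.inr ?_))
    rw [Finset.coe_union]
    exact Or.inr hx

variable {L₁ : Type u} [Field L₁] [Algebra K L₁]

/-- `Nr_{L₁}(A′) ⊆ O₁` for a model `A′ ⊆ K°` and `O₁` over `K°`. [folklore] -/
theorem nrIn_map_le_valuationSubring {O : ValuationSubring K} {A' : Subring K}
    (hA' : A' ≤ O.toSubring) (O₁ : ValuationSubring L₁) (hO₁ : O₁.comap (algebraMap K L₁) = O) :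
    nrIn (A'.map (algebraMap K L₁)) ≤ O₁.toSubring := by
  intro x hx
  refine mem_valuationSubring_of_isIntegral_subring O₁ ?_ (mem_nrIn_iff.mp hx)
  rintro _ ⟨a, ha, rfl⟩
  have h : a ∈ O₁.comap (algebraMap K L₁) := by
    rw [hO₁]
    exact hA' ha
  exact h

/-- **Fine models exhaust the valuation ring.** Let `O` be a valuation ring of `K` of finite
height, `k° ↦ R₀ ⊆ O`, `A` an affine normalized model of `K°` over `k°`, `L₁ ⊇ K` finite and
`O₁` a valuation ring of `L₁` over `O`. For every finite `W ⊆ O₁` there are an affine normalized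
model `A′ ≥ A` and `f ∈ Nr_{L₁}(A′)` with `|f|_{O₁} = 1` such that every `w ∈ W` is `a / fⁿ`
with `a ∈ Nr_{L₁}(A′)`: the local ring of `Nr_{L₁}(A′)` at the centre of `O₁` — even the basic
open `Nr_{L₁}(A′)[1/f]` — contains `W`. [folklore] -/
theorem exists_fine_model [FiniteDimensional K L₁] (O : ValuationSubring K)
    (hO : ringKrullDim O < ⊤) {R₀ A : Subring K}
    (hA : IsAffineNormalizedModel O R₀ A) (O₁ : ValuationSubring L₁)
    (hO₁ : O₁.comap (algebraMap K L₁) = O) (W : Finset L₁) (hW : (↑W : Set L₁) ⊆ (O₁ : Set L₁)) :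
    ∃ A' : Subring K, A ≤ A' ∧ IsAffineNormalizedModel O R₀ A' ∧
      ∃ f : L₁, f ∈ nrIn (A'.map (algebraMap K L₁)) ∧ O₁.valuation f = 1 ∧
        ∀ w ∈ W, ∃ a ∈ nrIn (A'.map (algebraMap K L₁)), ∃ n : ℕ, w = a / f ^ n := by
  classical
  set φ := algebraMap K L₁ with hφ
  set O' : Subring L₁ := O.toSubring.map φ with hO'
  -- Bourbaki VI §8 Prop. 6 (tree: `Temkin2013_valuationRingOpen_holds`), normalized so that the
  -- denominator is a unit of `O₁`
  have hrep1 : ∃ f : L₁, IsIntegral O' f ∧ O₁.valuation f = 1 ∧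
      ∀ w : W, ∃ a : L₁, IsIntegral O' a ∧ ∃ n : ℕ, (w : L₁) = a / f ^ n := by
    obtain ⟨f, hfint, hfW, hfinv, hrepr⟩ :=
      Temkin2013_valuationRingOpen_holds K L₁ inferInstance O hO O₁ hO₁
    have hrep : ∀ w : W, ∃ a : L₁, IsIntegral O' a ∧ ∃ n : ℕ, (w : L₁) = a / f ^ n :=
      fun w => (hrepr w).mp (hW w.2)
    by_cases hf0 : f = 0
    · refine ⟨1, isIntegral_one, by rw [map_one], fun w => ?_⟩
      obtain ⟨a, ha, n, hn⟩ := hrep w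
      by_cases hn0 : n = 0
      · exact ⟨a, ha, 0, by rw [hn, hn0, pow_zero, pow_zero]⟩
      · refine ⟨0, isIntegral_zero, 0, ?_⟩
        rw [hn, hf0, zero_pow hn0, div_zero, pow_zero, zero_div]
    · refine ⟨f, hfint, ?_, hrep⟩
      have hu : IsUnit (⟨f, hfW⟩ : O₁) :=
        isUnit_iff_exists_inv.mpr ⟨⟨f⁻¹, hfinv⟩, Subtype.ext (mul_inv_cancel₀ hf0)⟩
      exact (O₁.valuation_eq_one_iff _).mp hu
  obtain ⟨f, hfint, hvf, hrep⟩ := hrep1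
  choose a ha n hn using hrep
  -- the finite family of integral elements: `f` and the `a_w`
  let E : Finset L₁ := insert f (Finset.univ.image a)
  have hEint : ∀ e ∈ E, IsIntegral O' e := by
    intro e he
    rcases Finset.mem_insert.mp he with rfl | he
    · exact hfint
    · obtain ⟨w, -, rfl⟩ := Finset.mem_image.mp he
      exact ha w
  -- monic equations and preimages of their coefficients in `K°`
  choose p hpm hpe using fun e : E => hEint e.1 e.2
  have hpre : ∀ c : O', ∃ c₀ : K, c₀ ∈ O.toSubring ∧ φ c₀ = c := fun c => Subring.mem_map.mp c.2
  choose pre hpreO hpreφ using hpre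
  let s' : Finset K :=
    Finset.univ.biUnion fun e : E => (Finset.range ((p e).natDegree + 1)).image
      fun i => pre ((p e).coeff i)
  have hs'O : (↑s' : Set K) ⊆ (O : Set K) := by
    intro x hx
    obtain ⟨e, -, hx⟩ := Finset.mem_biUnion.mp (Finset.mem_coe.mp hx)
    obtain ⟨i, -, rfl⟩ := Finset.mem_image.mp hx
    exact hpreO _
  obtain ⟨A', hAA', hA', hs'A'⟩ := hA.refine s' hs'O
  -- every `e ∈ E` is integral over the image of `A′`
  have hEint' : ∀ e : E, (e : L₁) ∈ nrIn (A'.map φ) := by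
    intro e
    refine mem_nrIn_iff.mpr (isIntegral_of_monic_of_coeff_mem (A'.map φ)
      ((hpm e).map O'.subtype) (fun i => ?_) ?_)
    · rw [Polynomial.coeff_map]
      by_cases hi : i ≤ (p e).natDegree
      · refine Subring.mem_map.mpr ⟨pre ((p e).coeff i), hs'A' ?_, hpreφ _⟩
        refine Finset.mem_coe.mpr (Finset.mem_biUnion.mpr ⟨e, Finset.mem_univ _, ?_⟩)
        exact Finset.mem_image.mpr ⟨i, Finset.mem_range.mpr (Nat.lt_succ_of_le hi), rfl⟩
      · rw [Polynomial.coeff_eq_zero_of_natDegree_lt (not_le.mp hi), map_zero]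
        exact Subring.zero_mem _
    · have h := hpe e
      rw [Polynomial.eval_map]
      exact h
  have hfE : f ∈ E := Finset.mem_insert_self _ _
  have haE : ∀ w : W, a w ∈ E := fun w =>
    Finset.mem_insert_of_mem (Finset.mem_image.mpr ⟨w, Finset.mem_univ _, rfl⟩)
  refine ⟨A', hAA', hA', f, hEint' ⟨f, hfE⟩, hvf, fun w hw => ?_⟩
  exact ⟨a ⟨w, hw⟩, hEint' ⟨a ⟨w, hw⟩, haE ⟨w, hw⟩⟩, n ⟨w, hw⟩, hn ⟨w, hw⟩⟩

/-- **Fine generators, model-free form.** For `O` of finite height, `O₁` over `O` in a finite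
`L₁ ⊇ K` and a finite `W ⊆ O₁`, there are finitely many `s′ ⊆ K°` and `f ∈ L₁` with `|f|_{O₁} = 1`
such that for EVERY subring `A″ ⊇ s′` of `K`: `f ∈ Nr_{L₁}(A″)` and every `w ∈ W` is `a / fⁿ`
with `a ∈ Nr_{L₁}(A″)`. (The data `s′, f` depend only on `O, O₁, W` — not on a model; used to fix
the fine model before further, `W`-independent refinements.) [folklore] -/
theorem exists_fine_generators [FiniteDimensional K L₁] (O : ValuationSubring K)
    (hO : ringKrullDim O < ⊤) (O₁ : ValuationSubring L₁)
    (hO₁ : O₁.comap (algebraMap K L₁) = O) (W : Finset L₁) (hW : (↑W : Set L₁) ⊆ (O₁ : Set L₁)) :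
    ∃ (s' : Finset K) (f : L₁), (↑s' : Set K) ⊆ (O : Set K) ∧ O₁.valuation f = 1 ∧
      ∀ A'' : Subring K, (↑s' : Set K) ⊆ A'' →
        f ∈ nrIn (A''.map (algebraMap K L₁)) ∧
        ∀ w ∈ W, ∃ a ∈ nrIn (A''.map (algebraMap K L₁)), ∃ n : ℕ, w = a / f ^ n := by
  classical
  set φ := algebraMap K L₁ with hφ
  set O' : Subring L₁ := O.toSubring.map φ with hO'
  have hrep1 : ∃ f : L₁, IsIntegral O' f ∧ O₁.valuation f = 1 ∧
      ∀ w : W, ∃ a : L₁, IsIntegral O' a ∧ ∃ n : ℕ, (w : L₁) = a / f ^ n := by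
    obtain ⟨f, hfint, hfW, hfinv, hrepr⟩ :=
      Temkin2013_valuationRingOpen_holds K L₁ inferInstance O hO O₁ hO₁
    have hrep : ∀ w : W, ∃ a : L₁, IsIntegral O' a ∧ ∃ n : ℕ, (w : L₁) = a / f ^ n :=
      fun w => (hrepr w).mp (hW w.2)
    by_cases hf0 : f = 0
    · refine ⟨1, isIntegral_one, by rw [map_one], fun w => ?_⟩
      obtain ⟨a, ha, n, hn⟩ := hrep w
      by_cases hn0 : n = 0
      · exact ⟨a, ha, 0, by rw [hn, hn0, pow_zero, pow_zero]⟩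
      · refine ⟨0, isIntegral_zero, 0, ?_⟩
        rw [hn, hf0, zero_pow hn0, div_zero, pow_zero, zero_div]
    · refine ⟨f, hfint, ?_, hrep⟩
      have hu : IsUnit (⟨f, hfW⟩ : O₁) :=
        isUnit_iff_exists_inv.mpr ⟨⟨f⁻¹, hfinv⟩, Subtype.ext (mul_inv_cancel₀ hf0)⟩
      exact (O₁.valuation_eq_one_iff _).mp hu
  obtain ⟨f, hfint, hvf, hrep⟩ := hrep1
  choose a ha n hn using hrep
  let E : Finset L₁ := insert f (Finset.univ.image a)
  have hEint : ∀ e ∈ E, IsIntegral O' e := by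
    intro e he
    rcases Finset.mem_insert.mp he with rfl | he
    · exact hfint
    · obtain ⟨w, -, rfl⟩ := Finset.mem_image.mp he
      exact ha w
  choose p hpm hpe using fun e : E => hEint e.1 e.2
  have hpre : ∀ c : O', ∃ c₀ : K, c₀ ∈ O.toSubring ∧ φ c₀ = c := fun c => Subring.mem_map.mp c.2
  choose pre hpreO hpreφ using hpre
  let s' : Finset K :=
    Finset.univ.biUnion fun e : E => (Finset.range ((p e).natDegree + 1)).image
      fun i => pre ((p e).coeff i)
  have hs'O : (↑s' : Set K) ⊆ (O : Set K) := by
    intro x hx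
    obtain ⟨e, -, hx⟩ := Finset.mem_biUnion.mp (Finset.mem_coe.mp hx)
    obtain ⟨i, -, rfl⟩ := Finset.mem_image.mp hx
    exact hpreO _
  have hfE : f ∈ E := Finset.mem_insert_self _ _
  have haE : ∀ w : W, a w ∈ E := fun w =>
    Finset.mem_insert_of_mem (Finset.mem_image.mpr ⟨w, Finset.mem_univ _, rfl⟩)
  refine ⟨s', f, hs'O, hvf, fun A'' hs'A'' => ?_⟩
  have hEint' : ∀ e : E, (e : L₁) ∈ nrIn (A''.map φ) := by
    intro e
    refine mem_nrIn_iff.mpr (isIntegral_of_monic_of_coeff_mem (A''.map φ)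
      ((hpm e).map O'.subtype) (fun i => ?_) ?_)
    · rw [Polynomial.coeff_map]
      by_cases hi : i ≤ (p e).natDegree
      · refine Subring.mem_map.mpr ⟨pre ((p e).coeff i), hs'A'' ?_, hpreφ _⟩
        refine Finset.mem_coe.mpr (Finset.mem_biUnion.mpr ⟨e, Finset.mem_univ _, ?_⟩)
        exact Finset.mem_image.mpr ⟨i, Finset.mem_range.mpr (Nat.lt_succ_of_le hi), rfl⟩
      · rw [Polynomial.coeff_eq_zero_of_natDegree_lt (not_le.mp hi), map_zero]
        exact Subring.zero_mem _
    · have h := hpe e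
      rw [Polynomial.eval_map]
      exact h
  refine ⟨hEint' ⟨f, hfE⟩, fun w hw => ?_⟩
  exact ⟨a ⟨w, hw⟩, hEint' ⟨a ⟨w, hw⟩, haE ⟨w, hw⟩⟩, n ⟨w, hw⟩, hn ⟨w, hw⟩⟩

end Models

end Literature.AlgebraicGeometry.Resolution

end
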